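import Literature.RepresentationTheory.HeisenbergGroup.SchrodingerSymplecticGenerators
import Literature.LinearAlgebra.QuadraticForm.IsotropicDualPairTransitive
import HarnessLib

/-!
# The POLARISATION MOVER: a unipotent root element of `Sp(X × Y)` is conjugate to a Siegel unipotent `n(b)`

Topic `RepresentationTheory/HeisenbergGroup`; namespace `Literature.RepresentationTheory.HeisenbergGroup` (Weil's polarised
currency of `SchrodingerSiegelParabolic.lean` / `SchrodingerSymplecticGenerators.lean`: `W = X × Y`, `A = alt (polar β)`,
`Sp(W) = symplecticGroup (polar β)`, Siegel unipotents `unipotentSp β b hb : (x, y) ↦ (x, y + b x)`).  KERNEL only: theorems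
(one private plumbing lemma), no definition, no named fact, no `sorry`.

* §1 `exists_eq_unipotentSp` — RECOGNITION: `u ∈ Sp(W)` preserving first coordinates and fixing `0 × Y` pointwise IS
  `n(b)`, `b x = (u(x,0)).2`, the symmetry `β x (b x') = β x' (b x)` being forced by `u` symplectic [Weil1964, n° 6: the
  elements `t₀(σ)` with `σ = (1, 0; ρ, 1)`]; `exists_conj_eq_unipotentSp` — if `u w = w + 𝔫 w` with `𝔫` `A`-skew and
  `g ∈ Sp(W)` carries `im 𝔫` into `0 × Y₁`, then `g u g⁻¹ = n(b)` with `b(X) ≤ Y₁` (`g⁻¹(0 × Y) ⊥ im 𝔫`, `ker 𝔫 ⊇ (im 𝔫)ᗮ`).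
* §2 the standard dual isotropic pairs `(X₁ × 0, 0 × Y₁)` of the polarisation (`β` pairing `X₁`, `Y₁` perfectly), in the
  hypothesis shape of `LinearAlgebra/QuadraticForm/IsotropicDualPairTransitive.lean`.
* §3 **`exists_symplectic_conj_eq_unipotentSp`** — THE MOVER: for `u = 1 + 𝔫` (`𝔫` skew, `𝔫² = 0`), a partner `I₂` making
  `(im 𝔫, I₂)` a dual isotropic pair and a standard target pair of the right dimension, some `g ∈ Sp(W)` has
  `g (im 𝔫) = 0 × Y₁`, `g I₂ = X₁ × 0`, `g u g⁻¹ = unipotentSp β b hb`, `b(X) ≤ Y₁` (Witt extension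
  `exists_isometry_map_dualPair_eq` + §1).  Its lift to the Schrödinger model is then the multiplication operator
  `unipotentEquivSB` (tree `unipotent_mem_MpPsi`), which is how the cell hodgecm-mathlib's rank-one theta dichotomy
  (row IV-4(c1), piece P4) consumes it; nothing here is specific to that application.

## References
* [Weil1964] A. Weil, *Sur certains groupes d'opérateurs unitaires*, Acta Math. 111 (1964), n° 5–6 (pp. 150–151).
* [Rangarao1993] R. Ranga Rao, Pacific J. Math. 157 (1993), §2.1 Lemma 2.1 (iv), §2.2 p. 338 (transitivity of `Sp`).
* [MoeglinVignerasWaldspurger1987] MVW, LNM 1291, Chap. 2 II.6 (`P(X) = M N`).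
-/

set_option autoImplicit false

namespace Literature.RepresentationTheory.HeisenbergGroup

universe u v w

section Recognise

variable {R : Type u} [CommRing R] {X : Type v} {Y : Type w} [AddCommGroup X] [Module R X] [AddCommGroup Y] [Module R Y]
  (β : X →ₗ[R] Y →ₗ[R] R)

/-- **an automorphism of `W = X × Y` which preserves first coordinates and fixes `0 × Y` pointwise is `(x, y) ↦ (x, y + b x)`**
with `b x = (u (x, 0)).2` (`unipotentσ b`). [cite: Weil1964, n° 6, p. 151] -/
theorem eq_unipotentσ_of_fst_eq_of_apply_inr (u : (X × Y) ≃ₗ[R] (X × Y)) (h₁ : ∀ w : X × Y, (u w).1 = w.1)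
    (h₂ : ∀ y : Y, u (0, y) = (0, y)) :
    ∃ b : X →ₗ[R] Y, (∀ x, b x = (u (x, 0)).2) ∧ (u : (X × Y) ≃ₗ[R] (X × Y)) = unipotentσ b := by
  refine ⟨(LinearMap.snd R X Y).comp ((u : (X × Y) →ₗ[R] (X × Y)).comp (LinearMap.inl R X Y)), fun x => rfl,
    LinearEquiv.ext fun w => ?_⟩
  obtain ⟨x, y⟩ := w
  have hsplit : u (x, y) = u (x, 0) + u (0, y) := by rw [← map_add, Prod.mk_add_mk, add_zero, zero_add]
  rw [unipotentσ_apply, hsplit, h₂, Prod.ext_iff]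
  refine ⟨?_, ?_⟩
  · rw [Prod.fst_add, h₁]; simp
  · rw [Prod.snd_add, add_comm]; rfl

variable [Invertible (2 : R)]

/-- **RECOGNITION OF SIEGEL UNIPOTENTS**: an element `u ∈ Sp(X × Y)` (the tree's `symplecticGroup (polar β)`) that preserves
first coordinates (`(u w).1 = w.1`, i.e. `u − 1` takes values in `0 × Y`) and fixes `0 × Y` pointwise IS `n(b) = unipotentSp β b hb`
for `b x = (u (x, 0)).2`; the symmetry `β x (b x') = β x' (b x)` is forced by `u` being symplectic (`⟨u(x,0), u(x',0)⟩ = ⟨(x,0),(x',0)⟩ = 0`).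
The shape in which [Weil1964, n° 6]'s `t₀(σ)` for lower-triangular `σ` and its lift `unipotentOp` are consumed.
[cite: Weil1964, n° 6, p. 151] -/
theorem exists_eq_unipotentSp (u : symplecticGroup (polar β))
    (h₁ : ∀ w : X × Y, ((u : (X × Y) ≃ₗ[R] (X × Y)) w).1 = w.1) (h₂ : ∀ y : Y, (u : (X × Y) ≃ₗ[R] (X × Y)) (0, y) = (0, y)) :
    ∃ (b : X →ₗ[R] Y) (hb : ∀ x x', β x (b x') = β x' (b x)),
      (∀ x, b x = ((u : (X × Y) ≃ₗ[R] (X × Y)) (x, 0)).2) ∧ u = unipotentSp β b hb := by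
  obtain ⟨b, hbx, hub⟩ := eq_unipotentσ_of_fst_eq_of_apply_inr (u : (X × Y) ≃ₗ[R] (X × Y)) h₁ h₂
  have hb : ∀ x x', β x (b x') = β x' (b x) := fun x x' => by
    have h := (mem_symplecticGroup (polar β) (u : (X × Y) ≃ₗ[R] (X × Y))).1 u.2 (x, 0) (x', 0)
    rw [hub] at h
    simpa [unipotentσ_apply, polar_apply, sub_eq_zero] using h
  exact ⟨b, hb, hbx, Subtype.ext (by rw [coe_unipotentSp]; exact hub)⟩

/-- **CONJUGATING A UNIPOTENT ROOT ELEMENT INTO THE SIEGEL RADICAL.**  Let `u ∈ Sp(X × Y)` act as `w ↦ w + 𝔫 w` with `𝔫`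
skew for the symplectic form `A = alt (polar β)` (`A (𝔫 v) w = −A v (𝔫 w)`; `A` non-degenerate), and let `g ∈ Sp(X × Y)` carry
the image of `𝔫` into `0 × Y₁` (`Y₁ ≤ Y`; e.g. the polarisation mover of
`LinearAlgebra/QuadraticForm/IsotropicDualPairTransitive.lean` applied to the dual pair `(im 𝔫, im 𝔫̄)`).  THEN
`g u g⁻¹ = n(b) = unipotentSp β b hb` is a SIEGEL UNIPOTENT with `b(X) ≤ Y₁`: `g u g⁻¹ w = w + g 𝔫 g⁻¹ w` has second
coordinates only, and kills `0 × Y` because `g⁻¹(0 × Y) ⊥ im 𝔫` (`0 × Y` is isotropic and contains `g (im 𝔫)`) while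
`ker 𝔫 ⊇ (im 𝔫)ᗮ` by skewness.  (Its lift to the Schrödinger model is MULTIPLICATION by `ψ(½ β(x, b x))`, tree
`unipotent_mem_mpPairs` / `unipotentEquivSB`.) [cite: Weil1964, n° 6, p. 151] [cite: MoeglinVignerasWaldspurger1987, Chap. 2 II.6] -/
theorem exists_conj_eq_unipotentSp (hN : (alt (polar β)).Nondegenerate) {𝔫 : (X × Y) →ₗ[R] (X × Y)}
    (hskew : ∀ v w, alt (polar β) (𝔫 v) w = - alt (polar β) v (𝔫 w))
    (u : symplecticGroup (polar β)) (hu : ∀ w, (u : (X × Y) ≃ₗ[R] (X × Y)) w = w + 𝔫 w)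
    (g : symplecticGroup (polar β)) (Y₁ : Submodule R Y)
    (hg : ∀ v, ∃ y ∈ Y₁, (g : (X × Y) ≃ₗ[R] (X × Y)) (𝔫 v) = (0, y)) :
    ∃ (b : X →ₗ[R] Y) (hb : ∀ x x', β x (b x') = β x' (b x)), (∀ x, b x ∈ Y₁) ∧ g * u * g⁻¹ = unipotentSp β b hb := by
  have hgA : ∀ v w, alt (polar β) ((g : (X × Y) ≃ₗ[R] (X × Y)) v) ((g : (X × Y) ≃ₗ[R] (X × Y)) w) = alt (polar β) v w :=
    (Heisenberg.PseudoSymplectic.mem_isometries (alt (polar β)) _).1 g.2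
  -- the conjugate, on vectors
  have hconj : ∀ w, ((g * u * g⁻¹ : symplecticGroup (polar β)) : (X × Y) ≃ₗ[R] (X × Y)) w =
      w + (g : (X × Y) ≃ₗ[R] (X × Y)) (𝔫 ((g : (X × Y) ≃ₗ[R] (X × Y)).symm w)) := fun w => by
    change (g : (X × Y) ≃ₗ[R] (X × Y)) ((u : (X × Y) ≃ₗ[R] (X × Y)) ((g : (X × Y) ≃ₗ[R] (X × Y)).symm w)) = _
    rw [hu, map_add, LinearEquiv.apply_symm_apply]
  -- `𝔫` kills `g⁻¹ (0 × Y)`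
  have hker : ∀ y : Y, 𝔫 ((g : (X × Y) ≃ₗ[R] (X × Y)).symm (0, y)) = 0 := fun y => by
    refine hN.1 _ fun w => ?_
    obtain ⟨y', -, hy'⟩ := hg w
    rw [hskew, ← hgA, LinearEquiv.apply_symm_apply, hy']
    simp [alt_apply, polar_apply]
  have h₁ : ∀ w : X × Y, (((g * u * g⁻¹ : symplecticGroup (polar β)) : (X × Y) ≃ₗ[R] (X × Y)) w).1 = w.1 := fun w => by
    obtain ⟨y, -, hyx⟩ := hg ((g : (X × Y) ≃ₗ[R] (X × Y)).symm w)
    rw [hconj, hyx, Prod.fst_add, add_zero]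
  have h₂ : ∀ y : Y, ((g * u * g⁻¹ : symplecticGroup (polar β)) : (X × Y) ≃ₗ[R] (X × Y)) (0, y) = (0, y) := fun y => by
    rw [hconj, hker, map_zero, add_zero]
  obtain ⟨b, hb, hbx, hv⟩ := exists_eq_unipotentSp β (g * u * g⁻¹) h₁ h₂
  refine ⟨b, hb, fun x => ?_, hv⟩
  obtain ⟨y, hy, hyx⟩ := hg ((g : (X × Y) ≃ₗ[R] (X × Y)).symm (x, 0))
  rw [hbx, hconj, hyx]
  simpa using hy

end Recognise

/-! ## §2 The standard dual isotropic pairs `(X₁ × 0, 0 × Y₁)` of a polarisation -/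

section StandardPair

variable {K : Type u} [Field K] {X : Type v} {Y : Type w} [AddCommGroup X] [Module K X] [AddCommGroup Y] [Module K Y]
  (β : X →ₗ[K] Y →ₗ[K] K)

/-- `X × 0` is isotropic for `alt (polar β)` (so is every `X₁ × 0`). [cite: Weil1964, n° 5, p. 150] -/
theorem isotropic_map_inl (X₁ : Submodule K X) :
    ∀ p ∈ X₁.map (LinearMap.inl K X Y), ∀ q ∈ X₁.map (LinearMap.inl K X Y), alt (polar β) p q = 0 := by
  rintro _ ⟨x, -, rfl⟩ _ ⟨x', -, rfl⟩
  simp [alt_apply, polar_apply]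

/-- `0 × Y` is isotropic for `alt (polar β)` (so is every `0 × Y₁`). [cite: Weil1964, n° 5, p. 150] -/
theorem isotropic_map_inr (Y₁ : Submodule K Y) :
    ∀ p ∈ Y₁.map (LinearMap.inr K X Y), ∀ q ∈ Y₁.map (LinearMap.inr K X Y), alt (polar β) p q = 0 := by
  rintro _ ⟨y, -, rfl⟩ _ ⟨y', -, rfl⟩
  simp [alt_apply, polar_apply]

/-- duality of `(0 × Y₁, X₁ × 0)`, first half: if `β(X₁, y) = 0` forces `y = 0` on `Y₁` then `0 × Y₁` meets `(X₁ × 0)ᗮ` trivially.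
[cite: Weil1964, n° 5, p. 150] -/
theorem disjoint_map_inr_orthogonal_map_inl (X₁ : Submodule K X) (Y₁ : Submodule K Y)
    (h : ∀ y ∈ Y₁, (∀ x ∈ X₁, β x y = 0) → y = 0) :
    Disjoint (Y₁.map (LinearMap.inr K X Y)) (LinearMap.BilinForm.orthogonal (alt (polar β)) (X₁.map (LinearMap.inl K X Y))) := by
  rw [Submodule.disjoint_def]
  rintro _ ⟨y, hy, rfl⟩ hp
  have hy0 : y = 0 := h y hy fun x hx => by
    have := (LinearMap.BilinForm.mem_orthogonal_iff.1 hp) (LinearMap.inl K X Y x) (Submodule.mem_map_of_mem hx)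
    simpa [alt_apply, polar_apply] using this
  simp [hy0]

/-- duality of `(0 × Y₁, X₁ × 0)`, second half: if `β(x, Y₁) = 0` forces `x = 0` on `X₁` then `X₁ × 0` meets `(0 × Y₁)ᗮ` trivially.
[cite: Weil1964, n° 5, p. 150] -/
theorem disjoint_map_inl_orthogonal_map_inr (X₁ : Submodule K X) (Y₁ : Submodule K Y)
    (h : ∀ x ∈ X₁, (∀ y ∈ Y₁, β x y = 0) → x = 0) :
    Disjoint (X₁.map (LinearMap.inl K X Y)) (LinearMap.BilinForm.orthogonal (alt (polar β)) (Y₁.map (LinearMap.inr K X Y))) := by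
  rw [Submodule.disjoint_def]
  rintro _ ⟨x, hx, rfl⟩ hp
  have hx0 : x = 0 := h x hx fun y hy => by
    have := (LinearMap.BilinForm.mem_orthogonal_iff.1 hp) (LinearMap.inr K X Y y) (Submodule.mem_map_of_mem hy)
    simpa [alt_apply, polar_apply] using this
  simp [hx0]

/-- membership in `0 × Y₁` in the shape `exists_conj_eq_unipotentSp` consumes: `p ∈ Y₁.map inr ↔ ∃ y ∈ Y₁, p = (0, y)`.
[cite: Weil1964, n° 5, p. 150] -/
theorem mem_map_inr_iff (Y₁ : Submodule K Y) (p : X × Y) : p ∈ Y₁.map (LinearMap.inr K X Y) ↔ ∃ y ∈ Y₁, p = (0, y) := by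
  constructor
  · rintro ⟨y, hy, rfl⟩; exact ⟨y, hy, rfl⟩
  · rintro ⟨y, hy, rfl⟩; exact ⟨y, hy, rfl⟩

/-- `dim (0 × Y₁) = dim Y₁`. [folklore] -/
private theorem finrank_map_inr [FiniteDimensional K Y] (Y₁ : Submodule K Y) :
    Module.finrank K ↥(Y₁.map (LinearMap.inr K X Y)) = Module.finrank K Y₁ :=
  LinearEquiv.finrank_eq (Submodule.equivMapOfInjective _ LinearMap.inr_injective Y₁).symm

end StandardPair

/-! ## §3 THE POLARISATION MOVER, packaged: a unipotent root element is conjugate in `Sp(X × Y)` to a Siegel unipotent -/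

section Mover

variable {K : Type u} [Field K] [Invertible (2 : K)] {X : Type v} {Y : Type w} [AddCommGroup X] [Module K X]
  [AddCommGroup Y] [Module K Y] [FiniteDimensional K X] [FiniteDimensional K Y] (β : X →ₗ[K] Y →ₗ[K] K)

/-- **THE POLARISATION MOVER** (piece P4 of the cell hodgecm-mathlib's rank-one theta dichotomy, generic form).  Let
`u ∈ Sp(X × Y)` act as `w ↦ w + 𝔫 w` with `𝔫` skew and square-zero for `A = alt (polar β)` (`A` non-degenerate, `2`
invertible), let `I₂` complete `im 𝔫` to a DUAL ISOTROPIC PAIR `(im 𝔫, I₂)` (in the application: `I₂ = im 𝔫̄` for the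
opposite root element), and let `(X₁ × 0, 0 × Y₁)` be a standard dual pair of the polarisation (`β` pairs `X₁` and `Y₁`
perfectly) with `dim Y₁ = dim im 𝔫`.  THEN there is `g ∈ Sp(X × Y)` with `g (im 𝔫) = 0 × Y₁`, `g I₂ = X₁ × 0`, and
`g u g⁻¹ = n(b)` a SIEGEL UNIPOTENT `unipotentSp β b hb` with `b(X) ≤ Y₁` — `exists_isometry_map_dualPair_eq`
(`LinearAlgebra/QuadraticForm/IsotropicDualPairTransitive.lean`, the Witt extension) + `exists_conj_eq_unipotentSp`.
[cite: Rangarao1993, §2.1 Lemma 2.1 (iv), §2.2 p. 338] [cite: Weil1964, n° 6, p. 151] -/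
theorem exists_symplectic_conj_eq_unipotentSp (hN : (alt (polar β)).Nondegenerate) {𝔫 : (X × Y) →ₗ[K] (X × Y)}
    (hskew : ∀ v w, alt (polar β) (𝔫 v) w = - alt (polar β) v (𝔫 w)) (hsq : 𝔫 ∘ₗ 𝔫 = 0)
    (u : symplecticGroup (polar β)) (hu : ∀ w, (u : (X × Y) ≃ₗ[K] (X × Y)) w = w + 𝔫 w)
    {I₂ : Submodule K (X × Y)} (hI₂ : ∀ p ∈ I₂, ∀ q ∈ I₂, alt (polar β) p q = 0)
    (hd₁ : Disjoint (LinearMap.range 𝔫) (LinearMap.BilinForm.orthogonal (alt (polar β)) I₂))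
    (hd₂ : Disjoint I₂ (LinearMap.BilinForm.orthogonal (alt (polar β)) (LinearMap.range 𝔫)))
    (X₁ : Submodule K X) (Y₁ : Submodule K Y)
    (h₁ : ∀ x ∈ X₁, (∀ y ∈ Y₁, β x y = 0) → x = 0) (h₂ : ∀ y ∈ Y₁, (∀ x ∈ X₁, β x y = 0) → y = 0)
    (hdim : Module.finrank K ↥(LinearMap.range 𝔫) = Module.finrank K Y₁) :
    ∃ g : symplecticGroup (polar β),
      (LinearMap.range 𝔫).map ((g : (X × Y) ≃ₗ[K] (X × Y)) : (X × Y) →ₗ[K] (X × Y)) = Y₁.map (LinearMap.inr K X Y) ∧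
      I₂.map ((g : (X × Y) ≃ₗ[K] (X × Y)) : (X × Y) →ₗ[K] (X × Y)) = X₁.map (LinearMap.inl K X Y) ∧
      ∃ (b : X →ₗ[K] Y) (hb : ∀ x x', β x (b x') = β x' (b x)), (∀ x, b x ∈ Y₁) ∧ g * u * g⁻¹ = unipotentSp β b hb := by
  have hA : LinearMap.IsAlt (alt (polar β)) := fun w => sub_self _
  -- `im 𝔫` is isotropic: `A (𝔫 v) (𝔫 w) = -A v (𝔫 𝔫 w) = 0`
  have hI₁ : ∀ p ∈ LinearMap.range 𝔫, ∀ q ∈ LinearMap.range 𝔫, alt (polar β) p q = 0 := by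
    rintro _ ⟨v, rfl⟩ _ ⟨w, rfl⟩
    have h0 : 𝔫 (𝔫 w) = 0 := by
      rw [← LinearMap.comp_apply, hsq, LinearMap.zero_apply]
    rw [hskew, h0, map_zero, neg_zero]
  obtain ⟨g, hg, hgI₁, hgI₂⟩ := Literature.LinearAlgebra.QuadraticForm.exists_isometry_map_dualPair_eq hA hN hI₁ hI₂ hd₁ hd₂
    (isotropic_map_inr β Y₁) (isotropic_map_inl β X₁) (disjoint_map_inr_orthogonal_map_inl β X₁ Y₁ h₂)
    (disjoint_map_inl_orthogonal_map_inr β X₁ Y₁ h₁) (hdim.trans (finrank_map_inr Y₁).symm)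
  refine ⟨⟨g, hg⟩, hgI₁, hgI₂, ?_⟩
  refine exists_conj_eq_unipotentSp β hN hskew u hu ⟨g, hg⟩ Y₁ fun v => ?_
  have hv : (g : (X × Y) →ₗ[K] (X × Y)) (𝔫 v) ∈ Y₁.map (LinearMap.inr K X Y) :=
    hgI₁ ▸ Submodule.mem_map_of_mem (LinearMap.mem_range_self 𝔫 v)
  exact (mem_map_inr_iff Y₁ _).1 hv

end Mover

end Literature.RepresentationTheory.HeisenbergGroup
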